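import Mathlib
import Literature.MathematicalPhysics.QuantumFieldTheory.Balaban1983to89.B13Lemma3Window
import Literature.MathematicalPhysics.QuantumFieldTheory.Balaban1983to89.TreeLengthTorusGeometry236

/-!
# `Balaban1983to89.B13Lemma3TorusData` — T. Bałaban, *Renormalization group approach to lattice gauge field theories.
II. Cluster expansions*, Commun. Math. Phys. **116** (1988) 1–22 [Balaban1988RG2Cluster]: the scale-k index data of
the resummation pp. 17–20 (Lemma 3) ON THE PAPERS' PERIODIC CARRIER — the bond layer of T₁^{(k)} behind G7 / (2.31)
p. 18 on the unit TORUS, the (L+2)⁴ anchors of pp. 19–20 on two nested tori, and the printed inputs (2.30), the volume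
law, (1.26), (2.27), (2.29) in the shapes of `B13Lemma3Assembly.bound238With_of_226` for the torus catalogue
`TreeLengthTorus.tsys`

statement-level skeleton of published theorems with citation tags; proofs where landed; nothing here is a claim about
the Yang–Mills mass gap

PDF held: `paper:balaban1988-cmp116-rg-ii-cluster` (journal page = PDF page + 0); pp. 12, 18–20 re-read this session
from the text layer `p0018.txt`–`p0020.txt` of that key; the sentences used are quoted below and, verbatim from the
renders, in the window module `…B13Lemma3Window` whose §§1–3 THIS module ports to the torus.

CITATION HEADER / WHAT IS REPRODUCED (unit `lit-balaban-r10` gen 10, B13 fold owner; SKELETON rows `B13.Lem3`,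
`B13.Eq2.31`, `B13.Eq2.30`, `B13.Eq1.26`, `B13.Eq2.27`, `B13.Eq2.29` of `HOME/lit-balaban-r10/ROWS-B13.md`, HOME =
`run/shared/lean/pub/lit-balaban/`; kind «model-instance on the torus»).  The one-theorem assembly
`B13Lemma3Assembly.bound238With_of_226` (r10 gen 5) proves (2.26) ⇒ (2.38) over ABSTRACT resummation data; the window
instance `B13Lemma3Window.bound238With_window` (gen 6) discharged every geometric input on the free-boundary window of
ℤ⁴ (cell DIVERGENCE: the papers' cubes live on a torus, [Balaban1987RG1] p. 251).  HERE the scale-k inputs are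
discharged on the TORUS, from theorems already in the tree:
* §1 (𝐃_k := `tsys d N`, cubes := the members): non-empty footprints; the upper half of (2.30) p. 18 *"d_k(Y) ≦
  M⁻⁴|Y| − 1"* (`TreeLengthTorus.torusTreeLen_le_card_sub_one`); the volume law in its REPAIRED additive form |Y| ≤
  4·2^d(1 + d_k(Y)) (`TreeLengthTorus.tvolumeLeaf`; the printed lower half of (2.30) fails at d_k = 0, HOME GAPS
  G-B13-P18-01); (1.26) p. 8 at any rate ≥ κ₀(4·2^d, 2d) (`TreeLengthTorus.ineq126_torus`); (2.27) per domain
  (`TreeLengthTorusGeometry.ineq227_tcubes`); (2.29) (`TreeLengthTorus.ineq229_torus`) — each in the `B13FamilySum` shape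
  the assembly consumes;
* §2 the bonds behind (2.31) and G7 p. 18 (*"The definition of Z₀ yields |P| ≧ ½M⁻⁴|Z₀∖Y₀|, because one bond in P
  may connect two cubes in Z₀∖Y₀"*; (2.3) p. 12: P ⊂ Y₀ᶜ = *"{b ∈ T₁^{(k)} : b ⊄ Y₀} ∖ {b₀(c) : c ∈ T^{(k+1)}}"*): a
  CONCRETE bond layer ON THE UNIT TORUS T₁^{(k)} with M·N sites per direction — bonds ⟨y, y + e_μ⟩ (wrap-around
  included), the M-cube of a site being the torus block map `TreeLengthTorusTransfer.tcoarse M N` — with `ttouch b` =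
  the ≤ 2 cubes of the endpoints, the fibre count |{y : y ∈ □}| = M^d (`card_tfibre`, a bijection with the window box
  `B13Lemma3Window.sites` through the covering map), `tavail Z₀ Y₀` = the bonds having an endpoint cube in Z₀∖Y₀ (⊇ the
  printed set: `mem_tavail`), |tavail| ≤ 2d·M^d·|Z₀∖Y₀| (`card_tavail_le`; print counts 4M⁴ bonds per cube);
* §3 the anchors of pp. 19–20 on TWO NESTED TORI (fine torus L·N′ cubes of π_k per direction, coarse torus N′ cubes of
  π_{k+1}, closure map Z ↦ Z′ = `TreeLengthTorusTransfer.tclosureDom L N′`), verbatim: *"with an additional sum over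
  (L + 2)⁴ cubes □′ from π_k, the cubes touching a fixed LM-cube in Z′_i"* — `tanchor Z′` := the classes of the window
  box `B13Lemma3Window.anchorBox L (natLift (tbase Z′))`, `card_tanchor_le` (≤ (L+2)^d) and `hanch_torus` (every Z̄
  with closure Z′ contains one of them; the deck transformations permute the boxes, `TreeLengthTorusGeometry.period`).
No `sorry`, no new named fact (D-0026); Mathlib + the two imported modules (`…B13Lemma3Window` for the window boxes
`anchorBox`/`sites` reused verbatim, `…TreeLengthTorusGeometry236` for the torus vocabulary) only; nothing existing is modified.  The
scale-(k+1) index data (admissible Z′₀, their torus components, (2.32) adapted) and the assembled Lemma 3 on the torus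
are in the sibling `…B13Lemma3Torus` (this unit), the torus components / (2.32) in `…B13Ineq232Torus`.

HONEST SCOPE.  (i) Index devices only: the bond VARIABLES B(b) stay the abstract `B13.StepData.Bond`/`Bv`; the
faithfulness of the over-count `tavail ⊇ {printed P-bonds}` is documentary (`mem_tavail`), exactly as in the window
module.  (ii) Constants are the tree's honest ones (M4 = 2d·M^d, print 4M⁴; volume constant 4·2^d; K₀(4·2^d, 2d),
κ₀(4·2^d, 2d)); (L+2)^d as printed.  (iii) `torusTreeLen` is the covering-space reading of d_j (READING D-pv22g2.1).
(iv) For N = 1, 2 the torus adjacency degenerates and every statement remains true as stated.  Value = kernel-checked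
carrier migration of the window bookkeeping to the periodic carrier, NOT summit progress.
-/

noncomputable section

namespace Literature.MathematicalPhysics.QuantumFieldTheory.Balaban1983to89.B13Lemma3TorusData

open Literature.MathematicalPhysics.QuantumFieldTheory.Balaban1983to89
open Literature.MathematicalPhysics.QuantumFieldTheory.Balaban1983to89.B13ScaleTransfer (Pt coarse coarse_eq_iff)
open Literature.MathematicalPhysics.QuantumFieldTheory.Balaban1983to89.TreeLengthTorus
open Literature.MathematicalPhysics.QuantumFieldTheory.Balaban1983to89.TreeLengthTorusGeometry
  (period proj_add_period exists_period_of_proj_eq ineq227_tcubes)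
open Literature.MathematicalPhysics.QuantumFieldTheory.Balaban1983to89.TreeLengthTorusTransfer
open Literature.MathematicalPhysics.QuantumFieldTheory.Balaban1983to89.TreeLengthTorusGeometry236 (exists_lift_of_mem_tclosure)
open Literature.MathematicalPhysics.QuantumFieldTheory.Balaban1983to89.B12TreeDecay (kappa₀ K₀ K₀_pos)
open Literature.MathematicalPhysics.QuantumFieldTheory.Balaban1983to89.B13Lemma3Window
  (anchorBox card_anchorBox sites card_sites)

variable {d : ℕ}

/-! ## §1. Scale-k inputs of the torus catalogue: footprints, (2.30) upper half, volume law, (1.26), (2.27), (2.29) -/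

section ScaleK

variable {N : ℕ} [NeZero N]

/-- Non-empty footprints: a torus localization domain is a NON-EMPTY family of cubes ([Balaban1987RG1] p. 257); the
hypothesis `hne` of `B13Lemma3Assembly.bound238With_of_226` for cubes := the members. [cite: Balaban1987RG1, §0 p.257] -/
theorem tdom_nonempty (Y : TDom d N) : Y.1.Nonempty := Y.2.1

/-- (2.30) p. 18, upper half, verbatim: *"d_k(Y) ≦ M⁻⁴|Y| − 1 (2.30) holding for localization domains Y ∈ 𝐃_k"* — for
`torusTreeLen` (`TreeLengthTorus.torusTreeLen_le_card_sub_one`), in the shape `d_k(Z₀) + 1 ≤ |cubes Z₀|` of the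
hypothesis `h230` of `bound238With_of_226`. [cite: Balaban1988RG2Cluster, (2.30) p.18] -/
theorem h230_torus (Zc : TDom d N) : torusTreeLen Zc.1 + 1 ≤ ((Zc.1).card : ℝ) := by
  have h := torusTreeLen_le_card_sub_one Zc.2.1 Zc.2.2
  linarith

/-- The volume law in its REPAIRED additive form `|Y| ≤ 4·2^d (1 + d_k(Y))` for every torus localization domain
(`TreeLengthTorus.tvolumeLeaf` through `B12TreeDecay.familySum_volBound_iff`) — the shape `B13FamilySum.VolBound` of the
hypothesis `hvol`; print uses the lower half of (2.30), false at d_k(Y) = 0 (HOME GAPS G-B13-P18-01). [cite: Balaban1988RG2Cluster, (2.30) p.18] -/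
theorem hvol_torus (d N : ℕ) [NeZero N] :
    B13FamilySum.VolBound (Finset.univ : Finset (TDom d N)) (fun Y : TDom d N => Y.1) (tsys d N).dj (4 * 2 ^ d) :=
  (B12TreeDecay.familySum_volBound_iff (tcubeSys d N) _).2 (tvolumeLeaf d N)

/-- (1.26) p. 8, *"Σ_{X∈𝐃_j, X⊃□′} exp(−κd_j(X)) ≦ O(1) (1.26) for κ sufficiently large"* — the sum p. 19 invokes as
*"(1.28), with κ replaced by δκ"*: ON THE TORUS, for every rate r ≥ κ₀(4·2^d, 2d) and every cube □′,
Σ_{X ∋ □′} e^{−r d(X)} ≤ K₀(4·2^d, 2d) (`TreeLengthTorus.ineq126_torus` through `B12TreeDecay.familySum_ineq126_iff`) — the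
shape `B13FamilySum.Ineq126` of the hypothesis `h126`. [cite: Balaban1988RG2Cluster, (1.26) p.8] -/
theorem h126_torus (d N : ℕ) [NeZero N] {r : ℝ} (hr : kappa₀ (4 * 2 ^ d) (2 * d) ≤ r) :
    B13FamilySum.Ineq126 (Finset.univ : Finset (TDom d N)) (fun Y : TDom d N => Y.1) (tsys d N).dj r
      (K₀ (4 * 2 ^ d) (2 * d)) :=
  (B12TreeDecay.familySum_ineq126_iff (tcubeSys d N) _ _).2 (ineq126_torus d N hr)

/-- (2.29) p. 18 ON THE TORUS in the shape `B13FamilySum.Ineq229` over the members (`TreeLengthTorus.ineq229_torus`):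
with the smallness conditions of `B12TreeDecay.ineq229_of_volumeLeaf`, Σ_𝐃 Π_{Y∈𝐃} α₆e^{−δκd_k(Y)} ≤ 1 for every Y₀.
[cite: Balaban1988RG2Cluster, (2.29) p.18] -/
theorem h229_torus (d N : ℕ) [NeZero N] (δ κ α₆ a₂ : ℝ) (hα₆ : 0 ≤ α₆) (ha₂ : 0 ≤ a₂)
    (hκ : kappa₀ (4 * 2 ^ d) (2 * d) + a₂ ≤ δ * κ)
    (hsmall : α₆ * Real.exp a₂ * K₀ (4 * 2 ^ d) (2 * d) * (4 * 2 ^ d) ≤ a₂) :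
    B13FamilySum.Ineq229 (Finset.univ : Finset (TDom d N)) (fun Y : TDom d N => Y.1) (tsys d N).dj α₆ (δ * κ) :=
  ineq229_torus d N δ κ α₆ a₂ hα₆ ha₂ hκ hsmall

/-- (2.27) p. 18 ON THE TORUS for the covering families of a torus localization domain X̄ (the hypothesis `h227'` of
`bound238With_of_226` at scale k + 1, p. 20: *"The inequality (2.27) is used for the remaining exponential factors"*):
`TreeLengthTorusGeometry.ineq227_tcubes`. [cite: Balaban1988RG2Cluster, (2.27) p.18] -/
theorem h227_torus (X : TDom d N) :
    B13FamilySum.Ineq227 (Finset.univ : Finset (TDom d N)) (fun Y : TDom d N => Y.1) (tsys d N).dj X.1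
      (torusTreeLen X.1) 5 :=
  ineq227_tcubes d N X

/-- The repaired volume law for ONE domain, `|Z| ≤ 4·2^d (1 + d(Z))` — the hypothesis `hvol1` at scale k + 1 (print,
p. 20: *"We use the factor exp(−δ½Lκd_{k+1}(Z)), and the inequality (2.30), to bound the exponentials by 1"*; the
multiplicative (2.30) fails at d(Z) = 0, HOME GAPS G-B13-P18-01). [cite: Balaban1988RG2Cluster, (2.30) p.18 (used at scale k+1, p.20)] -/
theorem hvol1_torus (Z : TDom d N) : ((Z.1).card : ℝ) ≤ 4 * 2 ^ d * (1 + torusTreeLen Z.1) :=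
  hvol_torus d N Z (Finset.mem_univ _)

end ScaleK

/-! ## §2. The bond layer behind G7 and (2.31) p. 18 on the unit torus T₁^{(k)} -/

section Bonds

variable {M N : ℕ} [NeZero M] [NeZero N]

/-- A bond of the unit TORUS lattice T₁^{(k)} (M·N sites per direction: N cubes of side M) as (initial site, direction):
⟨y, y + e_μ⟩, wrap-around bonds included ((2.3) p. 12: *"the set of bonds Y₀ᶜ = {b ∈ T₁^{(k)} : b ⊄ Y₀} ∖ {b₀(c) :
c ∈ T^{(k+1)}} … Here the symbol |P| means the number of bonds in the set P"*).  Index device only (the bond VARIABLES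
B(b) are `B13.StepData.Bond`/`Bv`); window version `B13Lemma3Window.LBond`. [cite: Balaban1988RG2Cluster, (2.3) p.12] -/
abbrev TBond (d M N : ℕ) : Type := TPt d (M * N) × Fin d

/-- The end site y + e_μ (mod M·N) of the bond ⟨y, y + e_μ⟩. [folklore] -/
def tbondEnd (b : TBond d M N) : TPt d (M * N) := Function.update b.1 b.2 (b.1 b.2 + 1)

variable (M N) in
/-- The cubes of π_k met by a bond of the unit torus: the M-cubes of its two endpoints (the M-cube of a site is the
torus block map `TreeLengthTorusTransfer.tcoarse M N`) — p. 18: *"one bond in P may connect two cubes in Z₀∖Y₀"*;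
window version `B13Lemma3Window.touch`. [cite: Balaban1988RG2Cluster, p.18 (before (2.31))] -/
def ttouch (b : TBond d M N) : Finset (TPt d N) := {tcoarse M N b.1, tcoarse M N (tbondEnd b)}

omit [NeZero M] [NeZero N] in
/-- A bond meets at most two cubes (p. 18: *"one bond in P may connect two cubes"*) — the hypothesis `htouch` of
`bound238With_of_226` (G7, `B13MayerDecoupling.card_le_two_mul_card_of_cover`). [cite: Balaban1988RG2Cluster, p.18 (before (2.31))] -/
theorem card_ttouch_le (b : TBond d M N) : (ttouch M N b).card ≤ 2 := Finset.card_le_two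

variable (M N) in
open Classical in
/-- The sites of the unit torus lying in the M-cube q̄ of π_k (the fibre of the block map over q̄). [cite: Balaban1987RG1, §0 p.257] -/
def tfibre (q : TPt d N) : Finset (TPt d (M * N)) := Finset.univ.filter fun y => tcoarse M N y = q

/-- Membership in the fibre. [folklore] -/
private theorem mem_tfibre {q : TPt d N} {y : TPt d (M * N)} : y ∈ tfibre M N q ↔ tcoarse M N y = q := by
  classical
  simp [tfibre]

/-- A window site belongs to the box `B13Lemma3Window.sites M x` iff its M-cube is x (re-derived; the window lemma
is private there). [folklore] -/
private theorem mem_sites_iff {x y : Pt d} : y ∈ sites M x ↔ coarse M y = x := by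
  have hM : 0 < M := Nat.pos_of_ne_zero (NeZero.ne M)
  rw [coarse_eq_iff hM]
  simp only [sites, Fintype.mem_piFinset, Finset.mem_Ico]
  constructor
  · intro h i
    obtain ⟨h1, h2⟩ := h i
    exact ⟨h1, by linarith⟩
  · intro h i
    obtain ⟨h1, h2⟩ := h i
    exact ⟨h1, by linarith⟩

/-- The negative of a period is a period. [folklore] -/
private theorem neg_period (K : ℕ) (k : Pt d) : -period K k = period K (-k) := by
  funext i
  simp [period]

/-- **An M-cube of the torus has M^d sites** (|□| = M^d, the printed M⁴ at d = 4): the covering map restricted to the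
window box `B13Lemma3Window.sites M (natLift q̄)` is a bijection onto the fibre over q̄ — injective because two sites of
one box differ by less than M ≤ M·N in every coordinate, surjective because ⌊·/M⌋ intertwines the deck groups
(`TreeLengthTorusTransfer.coarse_add_period`). [cite: Balaban1987RG1, §0 p.257] -/
theorem card_tfibre (q : TPt d N) : (tfibre M N q).card = M ^ d := by
  classical
  have hM : 0 < M := Nat.pos_of_ne_zero (NeZero.ne M)
  have hN : 0 < N := Nat.pos_of_ne_zero (NeZero.ne N)
  have hMz : (1 : ℤ) ≤ M := by exact_mod_cast hM
  have hNz : (1 : ℤ) ≤ N := by exact_mod_cast hN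
  set x₀ : Pt d := natLift q with hx₀
  -- the covering map is injective on the box
  have hinj : Set.InjOn (fun y : Pt d => proj (M * N) y) ↑(sites M x₀) := by
    intro y hy y' hy' hyy'
    have hcy := (mem_sites_iff (M := M)).1 (Finset.mem_coe.1 hy)
    have hcy' := (mem_sites_iff (M := M)).1 (Finset.mem_coe.1 hy')
    rw [coarse_eq_iff hM] at hcy hcy'
    obtain ⟨k, hk⟩ := exists_period_of_proj_eq hyy'
    rw [hk]
    have hk0 : k = 0 := by
      funext i
      obtain ⟨h1, h2⟩ := hcy i
      obtain ⟨h3, h4⟩ := hcy' i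
      rw [hk] at h3 h4
      simp only [Pi.add_apply, period, Nat.cast_mul] at h3 h4
      have hMN : (M : ℤ) * 1 ≤ (M : ℤ) * N := mul_le_mul_of_nonneg_left hNz (by positivity)
      rcases lt_trichotomy (k i) 0 with hlt | heq | hgt
      · exfalso
        have hk1 : k i ≤ -1 := by omega
        have hgt' : -(M : ℤ) < M * N * k i := by linarith
        have hle : (M : ℤ) * N * k i ≤ (M : ℤ) * N * (-1) := mul_le_mul_of_nonneg_left hk1 (by positivity)
        linarith
      · exact heq
      · exfalso
        have hk1 : 1 ≤ k i := by omega
        have hlt : (M : ℤ) * N * k i < M := by linarith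
        have hge : (M : ℤ) * N * 1 ≤ (M : ℤ) * N * k i := mul_le_mul_of_nonneg_left hk1 (by positivity)
        linarith
    rw [hk0]
    funext i
    simp [period]
  -- its image is the fibre
  have himg : (sites M x₀).image (proj (M * N)) = tfibre M N q := by
    ext y
    rw [Finset.mem_image, mem_tfibre]
    constructor
    · rintro ⟨z, hz, rfl⟩
      rw [tcoarse_proj, (mem_sites_iff (M := M)).1 hz, hx₀, proj_natLift]
    · intro hy
      have h1 : proj N x₀ = proj N (coarse M (natLift y)) := by
        rw [hx₀, proj_natLift, ← tcoarse_proj, proj_natLift, hy]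
      obtain ⟨k, hk⟩ := exists_period_of_proj_eq h1
      refine ⟨natLift y + period (M * N) (-k), (mem_sites_iff (M := M)).2 ?_, ?_⟩
      · rw [coarse_add_period hM N, hk, ← neg_period]
        simp
      · rw [proj_add_period, proj_natLift]
  rw [← himg, Finset.card_image_of_injOn hinj, card_sites]

variable (M N) in
open Classical in
/-- The bonds of the unit torus meeting the M-cube q̄: those starting at a site of q̄ and those ending at a site of q̄
(p. 18 counts *"4M⁴"* bonds per cube in (2.31), i.e. d·M^d; here each bond is listed at both endpoint cubes); window
version `B13Lemma3Window.bondsAt`. [cite: Balaban1988RG2Cluster, (2.31) p.18] -/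
def tbondsAt (q : TPt d N) : Finset (TBond d M N) :=
  Finset.univ.filter fun b => tcoarse M N b.1 = q ∨ tcoarse M N (tbondEnd b) = q

/-- Membership in `tbondsAt`. [folklore] -/
private theorem mem_tbondsAt {q : TPt d N} {b : TBond d M N} :
    b ∈ tbondsAt M N q ↔ tcoarse M N b.1 = q ∨ tcoarse M N (tbondEnd b) = q := by
  classical
  simp [tbondsAt]

/-- At most 2d·M^d bonds of the unit torus meet a cube (d = 4: 8M⁴; print's count per cube is 4M⁴). [cite: Balaban1988RG2Cluster, (2.31) p.18] -/
theorem card_tbondsAt_le (q : TPt d N) : (tbondsAt M N q).card ≤ 2 * d * M ^ d := by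
  classical
  set F : Finset (TBond d M N) := tfibre M N q ×ˢ (Finset.univ : Finset (Fin d)) with hF
  have hsub : tbondsAt M N q ⊆ F ∪ F.image (fun b => (Function.update b.1 b.2 (b.1 b.2 - 1), b.2)) := by
    intro b hb
    rcases mem_tbondsAt.1 hb with h | h
    · exact Finset.mem_union_left _ (Finset.mem_product.2 ⟨mem_tfibre.2 h, Finset.mem_univ _⟩)
    · refine Finset.mem_union_right _ (Finset.mem_image.2 ⟨(tbondEnd b, b.2), ?_, ?_⟩)
      · exact Finset.mem_product.2 ⟨mem_tfibre.2 h, Finset.mem_univ _⟩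
      · obtain ⟨y, μ⟩ := b
        simp only [tbondEnd, Function.update_self, Function.update_idem, add_sub_cancel_right,
          Function.update_eq_self]
  have hFcard : F.card = M ^ d * d := by
    rw [hF, Finset.card_product, card_tfibre, Finset.card_univ, Fintype.card_fin]
  calc (tbondsAt M N q).card ≤ (F ∪ F.image (fun b => (Function.update b.1 b.2 (b.1 b.2 - 1), b.2))).card :=
        Finset.card_le_card hsub
    _ ≤ F.card + (F.image (fun b => (Function.update b.1 b.2 (b.1 b.2 - 1), b.2))).card := Finset.card_union_le _ _
    _ ≤ F.card + F.card := Nat.add_le_add_left Finset.card_image_le _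
    _ = 2 * d * M ^ d := by rw [hFcard]; ring

variable (M N) in
/-- The bonds AVAILABLE to the large-field set P of a term (2.14) at fixed component Z₀ and fixed Y₀, ON THE TORUS: all
bonds meeting a cube of Z₀∖Y₀ — p. 12 *"For a given set P we take the smallest localization domain Z₀ ∈ 𝐃_k
containing Y₀ and P"* read with p. 18 *"The definition of Z₀ yields |P| ≧ ½M⁻⁴|Z₀∖Y₀|"* (cell transcript G7: Z₀ =
Y₀ ∪ {cubes meeting bonds of P}); an over-count of the printed P ⊂ Y₀ᶜ inside Z₀ (`mem_tavail`), which only enlarges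
the majorant; window version `B13Lemma3Window.avail`. [cite: Balaban1988RG2Cluster, p.12 (before (2.4)) and p.18 (before (2.31))] -/
def tavail (Zc : TDom d N) (Y₀ : Finset (TPt d N)) : Finset (TBond d M N) := (Zc.1 \ Y₀).biUnion (tbondsAt M N)

/-- **The bond count behind (2.31) on the torus**: |tavail Z₀ Y₀| ≤ 2d·M^d·|Z₀∖Y₀| (d = 4: 8M⁴ per cube of Z₀∖Y₀;
print: *"4M⁴"*) — the hypothesis `havail` of `bound238With_of_226` (`B13MayerDecoupling.sum_P_bound_231`). [cite: Balaban1988RG2Cluster, (2.31) p.18] -/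
theorem card_tavail_le (Zc : TDom d N) (Y₀ : Finset (TPt d N)) :
    ((tavail M N Zc Y₀).card : ℝ) ≤ (2 * d * M ^ d : ℝ) * ((Zc.1 \ Y₀).card : ℝ) := by
  have h : (tavail M N Zc Y₀).card ≤ (Zc.1 \ Y₀).card * (2 * d * M ^ d) := by
    calc (tavail M N Zc Y₀).card ≤ ∑ q ∈ Zc.1 \ Y₀, (tbondsAt M N q).card := Finset.card_biUnion_le
      _ ≤ ∑ q ∈ Zc.1 \ Y₀, 2 * d * M ^ d := Finset.sum_le_sum fun q _ => card_tbondsAt_le q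
      _ = (Zc.1 \ Y₀).card * (2 * d * M ^ d) := by rw [Finset.sum_const, smul_eq_mul]
  have h' : ((tavail M N Zc Y₀).card : ℝ) ≤ ((Zc.1 \ Y₀).card : ℝ) * (2 * d * M ^ d : ℝ) := by exact_mod_cast h
  linarith [h']

/-- Faithfulness of the over-count: a bond lying in Z₀ (both endpoint cubes in Z₀) and not inside Y₀ (an endpoint cube
outside Y₀) — every bond of the printed P ⊂ Y₀ᶜ ∩ Z₀ of pp. 12, 18 — is available. [cite: Balaban1988RG2Cluster, p.12 (before (2.4)) and p.18 (before (2.31))] -/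
theorem mem_tavail (Zc : TDom d N) (Y₀ : Finset (TPt d N)) {b : TBond d M N} (hsub : ttouch M N b ⊆ Zc.1)
    (hnot : ¬ ttouch M N b ⊆ Y₀) : b ∈ tavail M N Zc Y₀ := by
  classical
  rw [tavail, Finset.mem_biUnion]
  obtain ⟨q, hq, hqY⟩ := Finset.not_subset.1 hnot
  refine ⟨q, Finset.mem_sdiff.2 ⟨hsub hq, hqY⟩, mem_tbondsAt.2 ?_⟩
  rcases Finset.mem_insert.1 hq with h | h
  · exact Or.inl h.symm
  · exact Or.inr (Finset.mem_singleton.1 h).symm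

end Bonds

/-! ## §3. The anchors of pp. 19–20 on two nested tori: (L+2)^d cubes of π_k attached to a fixed LM-cube of Z′ -/

section Anchors

variable {L N' : ℕ} [NeZero L] [NeZero N']

omit [NeZero L] [NeZero N'] in
/-- Membership in the window box `B13Lemma3Window.anchorBox L b` (the π_k-cubes within sup-distance 1 of the L-block of
index b; re-derived, the window lemma is private there). [folklore] -/
private theorem mem_anchorBox_iff {b y : Pt d} :
    y ∈ anchorBox L b ↔ ∀ i, (L : ℤ) * b i - 1 ≤ y i ∧ y i ≤ (L : ℤ) * b i + L := by
  simp [anchorBox, Fintype.mem_piFinset, Finset.mem_Icc]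

/-- *"a fixed LM-cube in Z′_i"* (p. 20): a chosen cube of the (non-empty) torus domain Z′; window version
`B13Lemma3Window.base`. [cite: Balaban1988RG2Cluster, p.20 l.1 (a fixed LM-cube in Z′)] -/
def tbase (Z' : TDom d N') : TPt d N' := Z'.2.1.choose

/-- The chosen cube lies in Z′. [folklore] -/
private theorem tbase_mem (Z' : TDom d N') : tbase Z' ∈ Z'.1 := Z'.2.1.choose_spec

variable (L) in
/-- The anchors of Z′ ∈ 𝐃_{k+1} ON THE TORUS: the cubes of the fine torus (L·N′ per direction) which are classes of the
window box of π_k-cubes within sup-distance 1 of the L-block of the standard lift of the fixed LM-cube `tbase Z′` —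
pp. 19–20, verbatim: *"with an additional sum over (L + 2)⁴ cubes □′ from π_k, the cubes touching a fixed LM-cube in
Z′_i"*; window version `B13Lemma3Window.anchor`. [cite: Balaban1988RG2Cluster, pp.19–20 (the anchored (1.28)-sum)] -/
def tanchor (Z' : TDom d N') : Finset (TPt d (L * N')) :=
  (anchorBox L (natLift (tbase Z'))).image (proj (L * N'))

omit [NeZero L] in
/-- There are at most (L+2)^d anchors — the hypothesis `hLfac` of `bound238With_of_226` (d = 4: (L+2)⁴ as printed).
[cite: Balaban1988RG2Cluster, p.20 l.1 (the (L+2)⁴ cubes)] -/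
theorem card_tanchor_le (Z' : TDom d N') : ((tanchor L Z').card : ℝ) ≤ ((L : ℝ) + 2) ^ d := by
  have h : (tanchor L Z').card ≤ (L + 2) ^ d :=
    Finset.card_image_le.trans (card_anchorBox L (natLift (tbase Z'))).le
  exact_mod_cast h

/-- **Every Z̄ ∈ 𝐃_k whose closure is Z′ contains an anchor of Z′**, ON THE TORUS — the hypothesis `hanch` of
`bound238With_of_226` for the closure map Z ↦ Z′ = `tclosureDom L N′` (Z′ = the LM-cubes met by Z̃, p. 19 *"we
denote by Z′_i the smallest localization domain from 𝐃_{k+1} containing Z̃_i"*): the fixed LM-cube of Z′ is the class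
of the block `coarse L y` of a window cube y ∈ □̃(natLift ā) for a cube ā of Z̄
(`TreeLengthTorusGeometry236.exists_lift_of_mem_tclosure`); that block is a deck-translate of the L-block of the standard
lift of the fixed cube (`exists_period_of_proj_eq`), so the corresponding translate of natLift ā lies in the window
anchor box, and its class is ā (`proj_add_period`).  This is why the anchored (1.28)-sum of p. 19 runs over cubes
*"touching a fixed LM-cube in Z′_i"*. [cite: Balaban1988RG2Cluster, pp.19–20 (the anchored (1.28)-sum)] -/
theorem hanch_torus (Zc : TDom d (L * N')) : ∃ q ∈ tanchor L (tclosureDom L N' Zc), q ∈ Zc.1 := by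
  have hL : 0 < L := Nat.pos_of_ne_zero (NeZero.ne L)
  set Z' := tclosureDom L N' Zc with hZ'
  have hb : tbase Z' ∈ tclosure L N' Zc.1 := by
    have := tbase_mem Z'
    rwa [hZ', tclosureDom_val] at this
  obtain ⟨a, ha, y, hy, hproj⟩ :=
    exists_lift_of_mem_tclosure (x := fun a => natLift a) (fun a _ => proj_natLift a) hb
  -- the block of y is a deck-translate of the standard lift of the fixed cube
  have h1 : proj N' (coarse L y) = proj N' (natLift (tbase Z')) := by rw [hproj, proj_natLift]
  obtain ⟨k, hk⟩ := exists_period_of_proj_eq h1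
  have hblock := B13ScaleTransfer.mem_block.1 hy
  have hcoarse := (coarse_eq_iff hL y (coarse L y)).1 rfl
  refine ⟨a, Finset.mem_image.2 ⟨natLift a + period (L * N') k, mem_anchorBox_iff.2 fun i => ?_, ?_⟩, ha⟩
  · obtain ⟨hc1, hc2⟩ := hcoarse i
    obtain ⟨hb1, hb2⟩ := hblock i
    have hki : natLift (tbase Z') i = coarse L y i + (N' : ℤ) * k i := by
      have := congrFun hk i
      simpa [period] using this
    simp only [Pi.add_apply, period, Nat.cast_mul, hki]
    constructor <;> nlinarith
  · rw [proj_add_period, proj_natLift]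

end Anchors

end Literature.MathematicalPhysics.QuantumFieldTheory.Balaban1983to89.B13Lemma3TorusData

end
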